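import Summits.BirchSwinnertonDyer.BirchSwinnertonDyer.Theses.ErratumRoadFive
import Summits.BirchSwinnertonDyer.Rank1Residual.X11a.PrintDischargeMuTableRecords
import HarnessLib

/-!
# Route `ErratumRoadFive` (K2), crux `NonSurjCorner` (item stmt-BirchSwinnertonDyer-19065), child 19948
# `NonSurjCornerTwinMuAn`: the child BY NAME from kernel-checked μ SYMBOL TABLES at every leaf twin
# (lane B `bsd-stepL-corner5-p2` g8; theorems only)

HONEST FRAMING: nothing here proves BSD for any curve or class, and item 19948 (analytic `μ = 0` at the
non-surjective X11a leaf twins; class-wide = Greenberg Conj. 1.11 through the main conjecture) stays OPEN. This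
file is BOOKKEEPING that names, in the kernel, the currency in which lane B's g8 census is written.

* `NonSurjTwin.twinMuAn_of_laneCertificates` — the converse of corner-p1's
  `MultMu.laneCertificates_of_twinMuAn` (`…TwinMuOfLane`): if EVERY corner leaf twin `(Wd, p)`
  (`ClassX11a Wd p`, `ρ̄` not onto, `p ∈ {5,7}`, `p ∣ ord_p Δ_min`) carries the X11a lane certificate
  `X11a.MuAnZeroAt Wd p`, then the ROUTE decl `Theses.ErratumRoadFive.NonSurjCornerTwinMuAn` holds (the two
  texts differ only by `IsMultPAdicLFunctionOf f p 1 ↔ IsSplitMultPAdicLFunctionOf f p`,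
  `isMultPAdicLFunctionOf_one_iff`). So 19948 ⟺ «`X11a.MuAnZeroAt` at every leaf twin».
* `NonSurjTwin.twinMuAn_of_forall_muTable` — **19948 ⟸ a kernel-checkable μ symbol table at every leaf
  twin**: granted Mazur's fact on the Manin constant, if every corner leaf twin `(Wd, p)` admits a displayed
  central value `L(Wd,1) = ℓ·Ω` with `‖ℓ‖_p ≤ 1` and a μ symbol table `t` (sister cell bsd-print-x11a's
  schema `X11aPrintCertificates.MuTable`) at `p` passing the kernel recheck `t.checkRiemannSum` (exact unit
  Riemann sum at the displayed index), consistent with the split bit, together with the table's CLAIM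
  `t.ClaimFor Wd` (the identification of the displayed rationals with `u·ϖ₀·[a/pⁿ]⁺_{f₀}` — D-0014 claim
  level, nothing in the tree proves it), then `NonSurjCornerTwinMuAn` — via x11a part 8b's door
  `ClassX11a.muAnZeroAt_of_muTable_of_lRatio` (the Teichmüller-coset evaluation of the b2b certificate
  `‖[T^k](ϖL)‖ = ‖RS k n₀‖`, Mazur–Tate–Teitelbaum §I.12–13) and the previous theorem.

This is the class-wide SHAPE that the g8 census INSTANTIATES at every one of the 256 rank-0 Heegner twins of the
64 corner census pairs at `p = 5` (λ ∈ {0,2,3,4,5,6,7,9,10,11}), the 32 beyond-book pairs and two `p = 7`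
members — tables landed as `Theorems/ErratumRoadFiveNonSurjCornerTwinMuAnTables{Part1–4, AllPart1–8,
BBPart1–2, SevenPart1}.lean` (x11a's `MuTable.check` by `decide +kernel`; `checkRiemannSum` holds on all of them
by the same tactic, memo HOME/corner5/g8/CORNER5-P2-G8.md §6) — and nowhere else: the `∀` over all leaf
twins is exactly what is open. closes: none (T7).

References: [MazurTateTeitelbaum1986Invent] §I.10, §I.12–14; [SteinWuthrich2013] §3; [GreenbergLNM1716]
Conj. 1.11; [Mazur1978] Cor. 4.1; x11a `X11aPrintCertificates/ClaimMuTable{,RiemannSum}.lean`,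
`X11a/PrintDischargeMuTableRecords.lean`; corner-p1 `…NonSurjCornerTwinMuOfLane.lean`.
-/

set_option autoImplicit false
-- the summit-side namespace `Summit.BirchSwinnertonDyer.BirchSwinnertonDyer` repeats the summit name by design (D-0017 layout)
set_option linter.dupNamespace false

noncomputable section

open scoped Classical MatrixGroups ModularForm

namespace Summit.BirchSwinnertonDyer.BirchSwinnertonDyer.Theorems

open CongruenceSubgroup WeierstrassCurve Literature.NumberTheory.EllipticCurves
  Literature.NumberTheory.EllipticCurves.ModularForms
  Literature.NumberTheory.EllipticCurves.Rank1Residual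
  Literature.NumberTheory.EllipticCurves.Rank1Residual.X11aPrintCertificates
  Summit.BirchSwinnertonDyer.Rank1Residual

/-- **19948 from the X11a lane certificate at every leaf twin** (converse of
`MultMu.laneCertificates_of_twinMuAn`): if `X11a.MuAnZeroAt Wd p` holds at every corner leaf twin, then the
route decl `Theses.ErratumRoadFive.NonSurjCornerTwinMuAn`. At a split `p` the child's function
`IsMultPAdicLFunctionOf f p 1 L` is the lane's `IsSplitMultPAdicLFunctionOf f p L`
(`isMultPAdicLFunctionOf_one_iff`); at a non-split `p` both read `IsMultPAdicLFunctionOf f p (-1) L`.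
Bookkeeping; nothing asserted about any curve. [folklore] -/
theorem NonSurjTwin.twinMuAn_of_laneCertificates
    (h : ∀ (Wd : WeierstrassCurve ℚ) [Wd.IsElliptic] [Wd.IsGloballyMinimal] (p : ℕ) [Fact p.Prime],
      ClassX11a Wd p → ¬ Surj Wd p → (p = 5 ∨ p = 7) → p ∣ padicValInt p Wd.minimalDiscriminantInt →
      X11a.MuAnZeroAt Wd p) :
    Summit.BirchSwinnertonDyer.BirchSwinnertonDyer.Theses.ErratumRoadFive.NonSurjCornerTwinMuAn := by
  show Summit.BirchSwinnertonDyer.BirchSwinnertonDyer.Theorems.NonSurjCornerTwinMuAn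
  intro Wd _ _ p _ hXa hns h57 hv N _ f hf ϖ hϖ a L hsa hna hL
  obtain ⟨hnsp, hsp⟩ := h Wd p hXa hns h57 hv f hf ϖ hϖ
  by_cases hsplit : Wd.HasSplitMultiplicativeReductionAtPrime p
  · have ha : a = 1 := hsa hsplit
    subst ha
    exact hsp hsplit L ((isMultPAdicLFunctionOf_one_iff L).mp hL)
  · have ha : a = -1 := hna hsplit
    subst ha
    exact hnsp hsplit L hL

/-- **19948 from a kernel-checkable μ symbol table at every leaf twin.** Granted Mazur's fact
`mazur_not_dvd_maninConstant_of_odd` (for `‖ϖ₀‖_p = 1`): if every corner leaf twin `(Wd, p)` has a displayed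
central value `L(Wd,1) = ℓ·Ω_{Wd}` with `‖ℓ‖_p ≤ 1` and a μ symbol table `t` at `p` (x11a's `MuTable`) with
`t.checkRiemannSum = true` (the KERNEL's exact recheck of the unit Riemann sum at the displayed index, minimal;
Teichmüller cosets complete), the split-bit consistency, and the table's claim `t.ClaimFor Wd`, then the route decl
`Theses.ErratumRoadFive.NonSurjCornerTwinMuAn` — x11a's door `ClassX11a.muAnZeroAt_of_muTable_of_lRatio` at each
twin, then `twinMuAn_of_laneCertificates`. The hypothesis is the exact shape lane B's census rows instantiate
per twin; its `∀` over all leaf twins is what is open (Greenberg 1.11). CONDITIONAL; nothing booked.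
[cite: MazurTateTeitelbaum1986Invent, §I.10 Prop., §I.12–I.14] [cite: Mazur1978, Cor. 4.1]
[cite: SteinWuthrich2013, §3 and §4.2] [cite: GreenbergLNM1716, §1 Conj. 1.11 (p. 61)] -/
theorem NonSurjTwin.twinMuAn_of_forall_muTable (hM : mazur_not_dvd_maninConstant_of_odd)
    (h : ∀ (Wd : WeierstrassCurve ℚ) [Wd.IsElliptic] [Wd.IsGloballyMinimal] (p : ℕ) [Fact p.Prime],
      ClassX11a Wd p → ¬ Surj Wd p → (p = 5 ∨ p = 7) → p ∣ padicValInt p Wd.minimalDiscriminantInt →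
      ∃ (ℓ : ℚ) (t : MuTable), Wd.entireLFunction 1 = (ℓ : ℂ) * (Wd.realPeriodRat : ℂ) ∧
        ‖((ℓ : ℚ) : ℚ_[p])‖ ≤ 1 ∧ t.p = p ∧ t.checkRiemannSum = true ∧
        (Wd.HasSplitMultiplicativeReductionAtPrime p → t.split = true) ∧ t.ClaimFor Wd) :
    Summit.BirchSwinnertonDyer.BirchSwinnertonDyer.Theses.ErratumRoadFive.NonSurjCornerTwinMuAn := by
  refine NonSurjTwin.twinMuAn_of_laneCertificates fun Wd _ _ p _ hXa hns h57 hv ↦ ?_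
  obtain ⟨ℓ, t, hℓ, hℓ1, hp, ht, hts, hT⟩ := h Wd p hXa hns h57 hv
  exact hXa.muAnZeroAt_of_muTable_of_lRatio hM ℓ hℓ hℓ1 t hp ht hts hT

end Summit.BirchSwinnertonDyer.BirchSwinnertonDyer.Theorems

end
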